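import Summits.Langlands.Langlands.Theses.AbelianSurfaceSerre

/-!
# Disproof of `QuadraticImprimitiveSurfaces` (stmt-Langlands-17766) — findings

Crux K2 of route `AbelianSurfaceSerre`: every abelian surface `A/ℚ` with `End_ℚ(A) = ℤ` whose
dual Tate representation `r = (V_p A)^∨ ⊗ ℚ̄_p` becomes reducible over some quadratic field `K`
is modular (L-algebraic cuspidal `π` on `GL₄/ℚ`, a.e. Satake–Frobenius compatible, `m = 1`).

**Verdict of cdisprove cycle 1 (2026-08-17): NO KILL; the statement resists for structural
reasons recorded below.**  Index of the Lean content (everything outside `NearMiss` is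
sorry-free):

* §1 ANATOMY. `ModularityClause`, `IsQuadImprimitive`, `IsDualTateFraming`, `EndTrivial` and
  `crux_iff` / `target_iff` (`Iff.rfl`): the crux is *literally* the Target `EndTrivialSurfacesModular`
  (rank 0, stmt-Langlands-17764) with ONE extra, genuine hypothesis `IsQuadImprimitive p r`.
  Hence `of_target : Target → K2`, `not_target_of_not : ¬K2 → ¬Target`, and under K1 + the printed
  reduction `iff_target_of_serre : K2 ↔ Target`.  CONSEQUENCE FOR DISPROVERS: any kill of K2 is a
  kill of the Target, i.e. a non-modular abelian surface over `ℚ` with `End_ℚ = ℤ` — a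
  counterexample to BCGP's paramodularity / to conjunct (B) of the summit for `n = 4`.  No candidate
  is known (BCGP 2025 Thm 1.1 + §10.1: 11743 LMFDB curves modular; Rem. 10.2.2 "remains open", not
  "in doubt").
* §2 LOAD-BEARING ANALYSIS, hypothesis by hypothesis.
  - `A.dim = 2`: NOT load-bearing — `dim_eq_two_of_basis`, `withoutDim_of` (it follows from the
    binder `b : Basis (Fin 4) ℚ_p (V_p A)` modulo the vendored rank fact
    `AbelianVariety.finrank_rationalTateModule_eq`, Mumford §19).
  - `IsQuadImprimitive`: dropping it gives the Target VERBATIM (`target_iff`), so it is not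
    load-bearing for truth (both believed); it is cheap in isolation: the trivial representation
    meets it (`one_isQuadImprimitive`, K = ℚ(ζ₃)).  All the strength of K2 therefore sits in the
    abelian-variety framing + `End_ℚ(A) = ℤ`.
  - `IsDualTateFraming` (r comes from an abelian surface): LOAD-BEARING — the representation-level
    statement `RepLevel` (drop `A`, keep imprimitivity) is false in nature, witness `r = 1`
    (`one_isQuadImprimitive` + Jacquet–Shalika: no cuspidal `π` on `GL₄` has Satake parameter
    `{1,1,1,1}` a.e.); near-miss `NearMiss.not_repLevel` (the automorphic half is fact-level only).
  - `EndTrivial` (`End_ℚ(A) = ℤ`): LOAD-BEARING — witness `A = E × E'` (or any `A` with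
    `End_ℚ(A) ≠ ℤ`): `r` is then reducible over `ℚ` already, a fortiori quadratically imprimitive,
    and only the ISOBARIC sum `π_E ⊞ π_E'` matches its Satake data (JS 1981 Thm 4.4), never a
    cuspidal `π`; near-miss `NearMiss.not_withoutEnd` (no `AbelianVariety ℚ` term with `dim = 2`
    is constructible in the tree, and JS is fact-level).  Its positive role: with Faltings it makes
    `r` irreducible over `ℚ`, so imprimitivity forces `r ≃ Ind_K^ℚ s` (Clifford; the ideators'
    `Sketch.ImprimitiveIsInduced`).
* §3 NORMALISATION PAPER-CHECK (no misstated kill).  With `m = 1`,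
  `arithFrobPolyOfSatake ι q 1 a = ∏ (X - ι⁻¹(a_j⁻¹))` must be the ARITHMETIC-Frobenius polynomial
  of `r = (V_p A)^∨`, whose eigenvalues are `β_j⁻¹` (`β_j` = Frobenius eigenvalues on `V_p A`, Weil
  numbers, `|β_j| = √q`, `∏ β_j = q²`); so `a_j = ι(β_j)`, `|a_j| = √q`, central character
  `ω_π(ϖ_v) = e₄(a) = q²` a.e. ⇒ `ω_π = |·|⁻²` ⇔ `det r = ε_p⁻²` ✓; `π = π_u ⊗ |det|^(-1/2)` with
  `π_u` the unitary transfer of the weight-(2,2) Siegel form, archimedean exponents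
  `{½,½,-½,-½} - ½ = {0,0,-1,-1}` ∈ ℤ ⇒ L-algebraic ✓ (and NOT regular — so the strengthening
  "`π` regular algebraic" is false in nature: HT weights `{0,0,1,1}`).  Same clause as the Target and
  as the accepted fact `bcgp_switch_exists_modular_abelianSurface`; calibrated on `GL₁`
  (`|·| ↔ ε_p`: Satake `q⁻¹`, arithmetic Frobenius `q`).  Checked twice (rattack seat + this seat).
* §4 WHY IT RESISTS.  (a) No finite/decidable shadow: every binder is an infinite interface
  (`AbelianVariety` = proper geometrically-integral group scheme, `CuspidalAutomorphicRepData` =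
  `W/W'` on cusp forms with Hecke-eigen Satake data) — neither a junk counterexample `A` nor a proof
  that no `π` exists is expressible without the objects themselves.  (b) In nature the class splits
  as (i) `Res_{K/ℚ} E`, `K` real quadratic: THEOREM (Freitas–Le Hung–Siksek 2015 + automorphic
  induction; tree facts `FreitasLeHungSiksek2015_thm1`, `automorphicInduction_cyclic_cuspidal…`);
  (ii) `K` imaginary quadratic: Caraiani–Newton 2023 / Allen–Khare–Thorne density-one + open
  residue; (iii) simple `A` with RM over real quadratic `K`, `3,5,7` inert in the RM field: OPEN
  (BCGP 2025 Rem. 10.2.2).  A kill needs a NON-automorphic `GL₂`-type motive over a quadratic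
  field; none is known or suspected; Ramakrishna-type infinitely ramified `r` are excluded by the
  geometric origin (`IsDualTateFraming`).  (c) Barrier catalogue (`Literature/Barriers/Langlands/*`:
  Taylor–Wiles numerical coincidence, patching local components): these constrain PROOFS of K2
  (l₀ = 1 in the Bianchi half), not its truth — no barrier yields a counterexample.
* §5 NOTES FOR PROVERS met while attacking.  (a) No degenerate-rank door: `n = 4`, `Fin 4` and
  `dim = 2` are hard-wired (contrast `ledger negatives`: OrdinaryPrimeTransport died at `n = 0`);
  `p = 2` and places of bad reduction are absorbed by `∀ᶠ v in cofinite`.  (b) The imprimitivity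
  hypothesis is handed to you AT THE SAME `p` as the conclusion; moving it to another prime `p'`
  (e.g. to work `3`-adically as the cards `ellenberg-f9-…`, `klingen-cm-…` do) needs Faltings'
  isogeny theorem `End_K(A) ⊗ ℚ_p ≃ End_{Γ_K}(V_p A)` (reducible at `p` ⇒ `End_K(A) ≠ ℤ` ⇒ reducible
  at every `p'`) — fact-level in the tree, budget for it.  (c) `π` may depend on `(p, b, r, ι)`;
  nature gives one `π` for all — you never need that.  (d) The clause asks `IsLAlgebraic`, not
  `IsRegularAlgebraic`: the `π` you must produce is `AI`/transfer twisted by `|det|^(-1/2)`, NOT the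
  unitary one (central character `|·|⁻²`, Satake moduli `√q`).
* §6 TARGETS: none yet (no line picked, `stuck_stubs = []`).

Search log: `lit search` (local daemon reset ×1, degraded), `ledger negatives --problem Langlands`
(3 entries, none on abelian surfaces / GL₂-type over quadratic fields).
-/

set_option linter.dupNamespace false -- project-wide option; `Summit.Langlands.Langlands` is the mandated namespace

namespace Summit.Langlands.Langlands.Cruxes.QuadraticImprimitiveSurfaces.Disproof

open Summit.Langlands.Langlands.Theses.AbelianSurfaceSerre
open Literature.NumberTheory.GaloisRepresentations Literature.NumberTheory.Automorphic
open Literature.AlgebraicGeometry.Motives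
open IsDedekindDomain NumberField Field

noncomputable section

/-! ## §1 Anatomy: the crux is the Target plus one hypothesis -/

section Anatomy

variable (p : ℕ) [Fact p.Prime]

/-- The conclusion clause of K2 — verbatim the conclusion clause of the Target
`EndTrivialSurfacesModular` (L-normalisation `m = 1`). -/
def ModularityClause (r : FramedGaloisRep ℚ (PadicAlgCl p) 4) : Prop :=
  ∀ (hcpt : isCompact_glFiniteIntegralLevel 4 ℚ) (ι : PadicAlgCl p ≃+* ℂ),
    ∃ π : CuspidalAutomorphicRepData 4 ℚ hcpt, π.1.IsLAlgebraic ∧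
      ∀ᶠ v : HeightOneSpectrum (𝓞 ℚ) in Filter.cofinite, ∃ a : Multiset ℂ,
        π.1.HasSatakeParamAt v a ∧ r.IsUnramifiedAt v ∧
          r.HasFrobCharpolyAt v (arithFrobPolyOfSatake ι v.residueCard 1 a)

/-- The one hypothesis distinguishing K2 from the Target: `r|_{Γ_K}` is reducible for some
quadratic number field `K` (restriction along the tree's chosen, injective
`absGaloisRestrict ℚ K`; irreducibility = Mathlib `Representation.IsIrreducible`, i.e.
`IsSimpleOrder (Subrepresentation _)`). -/
def IsQuadImprimitive (r : FramedGaloisRep ℚ (PadicAlgCl p) 4) : Prop :=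
  ∃ (K : Type) (_ : Field K) (_ : NumberField K),
    Module.finrank ℚ K = 2 ∧ ¬ FramedRep.IsIrreducible (r.restrictField K)

/-- The framing hypothesis: `r` is the contragredient of `V_p A` written in the basis `b`
(`r g = (M_b(ρ_A(g⁻¹)))ᵀ`, a homomorphism). -/
def IsDualTateFraming (A : AbelianVariety ℚ)
    (b : Module.Basis (Fin 4) ℚ_[p] (A.rationalTateModule p))
    (r : FramedGaloisRep ℚ (PadicAlgCl p) 4) : Prop :=
  ∀ g : absoluteGaloisGroup ℚ, (r g).val =
    ((LinearMap.toMatrix b b (A.rationalTateRep p g⁻¹)).map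
      (algebraMap ℚ_[p] (PadicAlgCl p))).transpose

/-- `End_ℚ(A) = ℤ · id`. -/
def EndTrivial (A : AbelianVariety ℚ) : Prop :=
  ∀ f : A ⟶ A, ∃ n : ℤ, f = n • CategoryTheory.CategoryStruct.id A

/-- K2 unfolded (definitional). -/
theorem crux_iff : QuadraticImprimitiveSurfaces ↔
    ∀ (A : AbelianVariety ℚ), A.dim = 2 → EndTrivial A →
      ∀ (p : ℕ) [Fact p.Prime] (b : Module.Basis (Fin 4) ℚ_[p] (A.rationalTateModule p))
        (r : FramedGaloisRep ℚ (PadicAlgCl p) 4),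
        IsDualTateFraming p A b r → IsQuadImprimitive p r → ModularityClause p r :=
  Iff.rfl

/-- The Target unfolded (definitional): the same, WITHOUT `IsQuadImprimitive`. -/
theorem target_iff : EndTrivialSurfacesModular ↔
    ∀ (A : AbelianVariety ℚ), A.dim = 2 → EndTrivial A →
      ∀ (p : ℕ) [Fact p.Prime] (b : Module.Basis (Fin 4) ℚ_[p] (A.rationalTateModule p))
        (r : FramedGaloisRep ℚ (PadicAlgCl p) 4),
        IsDualTateFraming p A b r → ModularityClause p r :=
  Iff.rfl

/-- K2 is a restriction of the Target (rank 0). -/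
theorem of_target (h : EndTrivialSurfacesModular) : QuadraticImprimitiveSurfaces :=
  fun A hd hE p _ b r hr _ => h A hd hE p b r hr

/-- Contrapositive: a refutation of K2 refutes the Target (kill criterion (c) = (a) of the route). -/
theorem not_target_of_not (h : ¬ QuadraticImprimitiveSurfaces) : ¬ EndTrivialSurfacesModular :=
  fun ht => h (of_target ht)

/-- Under K1 and the printed reduction (support item), K2 is EQUIVALENT to the Target. -/
theorem iff_target_of_serre (h₁ : SerreGSp4Surjective) (hF : BCGPSerreReduction) :
    QuadraticImprimitiveSurfaces ↔ EndTrivialSurfacesModular :=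
  ⟨fun h₂ => hF h₁ h₂, of_target⟩

end Anatomy

/-! ## §2 Load-bearing analysis -/

section Dim

variable (p : ℕ) [Fact p.Prime]

/-- `A.dim = 2` follows from the basis binder, modulo the vendored rank fact
`dim V_p A = 2 · dim A` (Mumford §19 p. 172; `AbelianVariety.finrank_rationalTateModule_eq`). -/
theorem dim_eq_two_of_basis (A : AbelianVariety ℚ) (hrk : A.finrank_rationalTateModule_eq p)
    (b : Module.Basis (Fin 4) ℚ_[p] (A.rationalTateModule p)) : A.dim = 2 := by
  have hp : ((p : ℕ) : ℚ) ≠ 0 := by exact_mod_cast (Fact.out : p.Prime).ne_zero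
  have h1 := hrk hp
  have h2 : Module.finrank ℚ_[p] (A.rationalTateModule p) = 4 := by
    simpa using Module.finrank_eq_card_basis b
  omega

/-- K2 with the hypothesis `A.dim = 2` dropped. -/
def WithoutDim : Prop :=
  ∀ (A : AbelianVariety ℚ), EndTrivial A →
    ∀ (p : ℕ) [Fact p.Prime] (b : Module.Basis (Fin 4) ℚ_[p] (A.rationalTateModule p))
      (r : FramedGaloisRep ℚ (PadicAlgCl p) 4),
      IsDualTateFraming p A b r → IsQuadImprimitive p r → ModularityClause p r

/-- `A.dim = 2` is NOT load-bearing: K2 implies its dim-free form (modulo the rank fact). -/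
theorem withoutDim_of
    (hrk : ∀ (A : AbelianVariety ℚ) (p : ℕ) [Fact p.Prime], A.finrank_rationalTateModule_eq p)
    (h : QuadraticImprimitiveSurfaces) : WithoutDim :=
  fun A hE p _ b r hr hK => h A (dim_eq_two_of_basis p A (hrk A p) b) hE p b r hr hK

/-- … and conversely (trivial weakening), so the two are equivalent modulo the rank fact. -/
theorem withoutDim_iff
    (hrk : ∀ (A : AbelianVariety ℚ) (p : ℕ) [Fact p.Prime], A.finrank_rationalTateModule_eq p) :
    WithoutDim ↔ QuadraticImprimitiveSurfaces :=
  ⟨fun h A _ hE p _ b r hr hK => h A hE p b r hr hK, withoutDim_of hrk⟩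

end Dim

section Imprimitive

variable (p : ℕ) [Fact p.Prime]

/-- `[ℚ(ζ₃) : ℚ] = 2` for the canonical `algebraRat` structure used by the crux. -/
theorem finrank_cyclotomicField_three' : Module.finrank ℚ (CyclotomicField 3 ℚ) = 2 := by
  obtain ⟨A, hA⟩ : ∃ A : Algebra ℚ (CyclotomicField 3 ℚ),
      @IsCyclotomicExtension {3} ℚ (CyclotomicField 3 ℚ) _ _ A :=
    ⟨_, CyclotomicField.isCyclotomicExtension 3 ℚ⟩
  have hAeq : A = (DivisionRing.toRatAlgebra : Algebra ℚ (CyclotomicField 3 ℚ)) :=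
    Subsingleton.elim _ _
  subst hAeq
  haveI := hA
  rw [IsCyclotomicExtension.Rat.finrank 3 (CyclotomicField 3 ℚ)]
  decide

/-- The trivial rank-4 representation of any profinite group is reducible: the line spanned by
`e₀` is a proper non-zero subrepresentation. -/
theorem not_isIrreducible_one {G : Type*} [Group G] [TopologicalSpace G] :
    ¬ FramedRep.IsIrreducible (1 : FramedRep G (PadicAlgCl p) 4) := by
  intro hirr
  have hρg : ∀ (g : G) (v : Fin 4 → PadicAlgCl p),
      FramedRep.toRepresentation (1 : FramedRep G (PadicAlgCl p) 4) g v = v := by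
    intro g v
    rw [FramedRep.toRepresentation_apply_apply]
    simp
  let e₀ : Fin 4 → PadicAlgCl p := Pi.single 0 1
  let e₁ : Fin 4 → PadicAlgCl p := Pi.single 1 1
  let σ₀ : Subrepresentation (FramedRep.toRepresentation (1 : FramedRep G (PadicAlgCl p) 4)) :=
    ⟨Submodule.span (PadicAlgCl p) {e₀}, fun g v hv => by rw [hρg]; exact hv⟩
  haveI := hirr
  rcases IsSimpleOrder.eq_bot_or_eq_top σ₀ with h | h
  · have hmem : e₀ ∈ σ₀.toSubmodule := Submodule.subset_span rfl
    have hbot : σ₀.toSubmodule = ⊥ := by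
      have := congrArg Subrepresentation.toSubmodule h
      exact this
    rw [hbot, Submodule.mem_bot] at hmem
    have h0 := congrFun hmem 0
    simp [e₀] at h0
  · have htop : σ₀.toSubmodule = ⊤ := by
      have := congrArg Subrepresentation.toSubmodule h
      exact this
    have hmem : e₁ ∈ σ₀.toSubmodule := by rw [htop]; exact Submodule.mem_top
    obtain ⟨c, hc⟩ := Submodule.mem_span_singleton.mp hmem
    have h1 := congrFun hc 1
    simp [e₀, e₁] at h1

/-- The imprimitivity hypothesis is cheap in isolation: the TRIVIAL framed representation meets it
(with `K = ℚ(ζ₃)`; any quadratic field works).  So `IsQuadImprimitive` carries no strength by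
itself — everything sits in the framing by an abelian surface with `End_ℚ = ℤ`. -/
theorem one_isQuadImprimitive :
    IsQuadImprimitive p (1 : FramedGaloisRep ℚ (PadicAlgCl p) 4) := by
  refine ⟨CyclotomicField 3 ℚ, inferInstance, inferInstance, finrank_cyclotomicField_three', ?_⟩
  -- restriction of the trivial representation is the trivial representation
  have : (1 : FramedGaloisRep ℚ (PadicAlgCl p) 4).restrictField (CyclotomicField 3 ℚ) =
      (1 : FramedGaloisRep (CyclotomicField 3 ℚ) (PadicAlgCl p) 4) :=
    ContinuousMonoidHom.ext fun _ => rfl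
  rw [this]
  exact not_isIrreducible_one p

/-- K2 with the abelian variety dropped: "every quadratically-imprimitive continuous
`r : Γ_ℚ → GL₄(ℚ̄_p)` satisfies the modularity clause". -/
def RepLevel : Prop :=
  ∀ (p : ℕ) [Fact p.Prime] (r : FramedGaloisRep ℚ (PadicAlgCl p) 4),
    IsQuadImprimitive p r → ModularityClause p r

/-- `RepLevel` is formally stronger than K2 (so its falsity says nothing against K2). -/
theorem of_repLevel (h : RepLevel) : QuadraticImprimitiveSurfaces :=
  fun _ _ _ p _ _ r _ hK => h p r hK

end Imprimitive

section EndTrivialSection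

/-- K2 with `End_ℚ(A) = ℤ` dropped. -/
def WithoutEnd : Prop :=
  ∀ (A : AbelianVariety ℚ), A.dim = 2 →
    ∀ (p : ℕ) [Fact p.Prime] (b : Module.Basis (Fin 4) ℚ_[p] (A.rationalTateModule p))
      (r : FramedGaloisRep ℚ (PadicAlgCl p) 4),
      IsDualTateFraming p A b r → IsQuadImprimitive p r → ModularityClause p r

/-- `WithoutEnd` is formally stronger than K2. -/
theorem of_withoutEnd (h : WithoutEnd) : QuadraticImprimitiveSurfaces :=
  fun A hd _ p _ b r hr hK => h A hd p b r hr hK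

end EndTrivialSection

/-! ## Near-misses (the ONLY sorries of this file): false in nature, not closable in the tree -/

namespace NearMiss

/-- NEAR-MISS (false in nature, unprovable here).  Witness `r = 1` (meets `IsQuadImprimitive`,
`one_isQuadImprimitive`); `ModularityClause p 1` demands a cuspidal L-algebraic `π` on `GL₄/ℚ`
with Satake parameter `{1,1,1,1}` at a.e. `v` (`arithFrobPolyOfSatake ι q 1 a = (X-1)^4` forces
`a = {1,1,1,1}` as `ι` is injective), contradicting Jacquet–Shalika 1981 Thm 4.4 (strong
multiplicity one for isobaric reps: `π ≃ 1 ⊞ 1 ⊞ 1 ⊞ 1`, not cuspidal) — equivalently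
Godement–Jacquet: `L^S(s, π)` is entire for cuspidal `π` on `GL_n`, `n ≥ 2`, while here
`L^S(s,π) = ζ^S(s)^4`.  OBSTRUCTION: the tree carries JS/GJ only as `def … : Prop` facts in the
`IsobaricDescent`/`partialPairL` vocabulary; threading them to `CuspidalAutomorphicRepData 4 ℚ`
with `HasSatakeParamAt v {1,1,1,1}` cofinitely is a facts-worker job, not a disproof of K2
(K2 itself is untouched: `of_repLevel` goes the wrong way).  Tried: `exact?`/`aesop` on the
automorphic half — fail (no lemma mentions `CuspidalAutomorphicRepData` negatively). -/
theorem not_repLevel : ¬ RepLevel := by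
  sorry

/-- NEAR-MISS (false in nature, unprovable here).  Witness: `A = E × E'` for non-isogenous
elliptic curves over `ℚ` (or ANY abelian surface with `End_ℚ(A) ≠ ℤ`): `r = V_p(E)^∨ ⊕ V_p(E')^∨`
is reducible over `ℚ`, hence `IsQuadImprimitive p r` holds for every quadratic `K`; both summands
are modular (Wiles/BCDT, tree fact `BCDTModularity`), so the isobaric `Π = π_E|·|^(-1/2) ⊞
π_E'|·|^(-1/2)` has the required Satake data a.e., and by Jacquet–Shalika 1981 Thm 4.4 no
CUSPIDAL `π` on `GL₄/ℚ` does.  OBSTRUCTIONS: (1) no term `A : AbelianVariety ℚ` with `A.dim = 2`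
is constructible in the tree (needs a proper group SCHEME of dimension 2 — products/Jacobians as
schemes with `GrpObj` structure are absent from Mathlib); (2) JS rigidity is fact-level (see
`not_repLevel`).  Hence `End_ℚ(A) = ℤ` is LOAD-BEARING: any proof of K2 must use it — in practice
through Faltings (`r` irreducible over `ℚ`) + Clifford (`r ≃ Ind_K^ℚ s`, `s` irreducible,
`s^σ ≄ s`), which is what makes `AI_K^ℚ` of the automorphic avatar of `s` CUSPIDAL. -/
theorem not_withoutEnd : ¬ WithoutEnd := by
  sorry

end NearMiss

end

end Summit.Langlands.Langlands.Cruxes.QuadraticImprimitiveSurfaces.Disproof
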